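import Summits.KontsevichZagierPeriods.KontsevichZagierPeriods.Theorems.EllipticMomentKernel.Negative.GeneralCurve
import Literature.NumberTheory.Transcendental.KZLogCalculusProofs

/-!
# `EllipticMomentKernel` (stmt-KontsevichZagierPeriods-10631), line `merge-first-single-hermite`:
# stub `stub_mergeToCarrier`

MERGE FIRST. For a rational Weierstrass cubic `f = cubic q₂ q₃ = 4x³ − q₂x − q₃` (bounded oval
`σ = oval q₂ q₃`), call a *carrier* a KZ integral representation `[σ, A(x) + B(x)/√f(x)]` with
`A, B ∈ ℚ[X]`. Assuming

* `hrep`: carriers exist for all `A, B` (with integrand LITERALLY `A + B/√f`), and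
* `hgen₂`: every 2-dimensional generator `[D, x^a y^b]` is congruent modulo `KZ.relations` to a
  carrier,

every element of the sector `AddSubgroup.closure (gens q₂ q₃)` is congruent modulo `KZ.relations`
to ONE carrier. This is pure bookkeeping in the free abelian group `KZ.FormalRep` by
`AddSubgroup.closure_induction`, the only move being rule 1b (additivity of the integrand on the
common domain `σ`):

* generators of the second kind `[σ, x^m/√f]` ARE carriers (`A = 0`, `B = X^m`);
* zero is congruent to the carrier `A = B = 0` (the zero representation on `σ`, `KZ.exists_zeroRep`
  over `isSemialgebraic_oval`), itself a relation (`KZ.of_mem_relations_of_eqOn_zero`);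
* a sum of two carriers `(A₁, B₁)`, `(A₂, B₂)` is congruent to the carrier `(A₁ + A₂, B₁ + B₂)` by ONE
  instance of `KZ.integrandAddRel`;
* the negative of a carrier `(A, B)` is congruent to the carrier `(−A, −B)`
  (`KZ.of_add_of_mem_relations_of_eqOn_neg`).

No analysis is involved; `0 < disc` enters only through the `ℚ`-semialgebraicity of `σ`.
-/

noncomputable section

open MeasureTheory Set
open scoped Polynomial

namespace Summit.KontsevichZagierPeriods.HermiteRigidity.EllipticMomentKernel

open Literature.NumberTheory.Transcendental
open Literature.NumberTheory.Transcendental.KZ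
open Summit.KontsevichZagierPeriods.HermiteRigidity.EllipticMomentKernelNegative
open Summit.KontsevichZagierPeriods.KontsevichZagierPeriods.Theses.HermiteRigidity
  (EllipticMomentKernel HermiteExactFormVanishes)

/-- **Stub `stub_mergeToCarrier`** (MERGE FIRST). Given that carrier representations
`[σ, A + B/√f]` exist (`hrep`) and that every 2-dimensional generator is congruent to a carrier
(`hgen₂`, the column move in carrier form), every element of the sector
`AddSubgroup.closure (gens q₂ q₃)` is congruent modulo `KZ.relations` to ONE carrier — closure
induction whose only move is rule 1b on the common domain `σ` (one `KZ.integrandAddRel` instance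
for sums, `KZ.of_add_of_mem_relations_of_eqOn_neg` for negatives; generators of the second kind are
carriers with `A = 0`, `B = X^m`; zero is the carrier `A = B = 0` — the zero representation on
`σ`, which exists because `σ` is `ℚ`-semialgebraic for `0 < disc` (`isSemialgebraic_oval`,
`KZ.exists_zeroRep`) and is a relation by `KZ.of_mem_relations_of_eqOn_zero`).
[cite: KontsevichZagier2001, §1.2 rule (1)] -/
theorem stub_mergeToCarrier (q₂ q₃ : ℚ) (hΔ : 0 < disc q₂ q₃)
    (hrep : ∀ A B : ℚ[X], ∃ s : IntegralRep 1, s.domain = oval q₂ q₃ ∧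
      s.integrand = fun p => (Polynomial.aeval (p 0) A : ℝ) +
        (Polynomial.aeval (p 0) B : ℝ) / Real.sqrt (cubic q₂ q₃ (p 0)))
    (hgen₂ : ∀ x ∈ gens₂ q₂ q₃, ∃ (A B : ℚ[X]) (s : IntegralRep 1), s.domain = oval q₂ q₃ ∧
      EqOn s.integrand (fun p => (Polynomial.aeval (p 0) A : ℝ) +
        (Polynomial.aeval (p 0) B : ℝ) / Real.sqrt (cubic q₂ q₃ (p 0))) (oval q₂ q₃) ∧
      x - KZ.of s ∈ KZ.relations) :
    ∀ c ∈ AddSubgroup.closure (gens q₂ q₃), ∃ (A B : ℚ[X]) (s : IntegralRep 1),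
      s.domain = oval q₂ q₃ ∧
      EqOn s.integrand (fun p => (Polynomial.aeval (p 0) A : ℝ) +
        (Polynomial.aeval (p 0) B : ℝ) / Real.sqrt (cubic q₂ q₃ (p 0))) (oval q₂ q₃) ∧
      c - KZ.of s ∈ KZ.relations := by
  intro c hc
  induction hc using AddSubgroup.closure_induction with
  | mem x hx =>
    rcases hx with hx | hx
    · -- a 2-dimensional generator: the column move in carrier form
      exact hgen₂ x hx
    · -- a generator of the second kind `[σ, x^m/√f]` is the carrier `A = 0`, `B = X^m`
      obtain ⟨r, m, hr, hri, rfl⟩ := hx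
      refine ⟨0, Polynomial.X ^ m, r, hr, fun p hp => ?_, ?_⟩
      · rw [hri hp]
        simp
      · rw [sub_self]
        exact relations.zero_mem
  | zero =>
    -- zero is congruent to the zero representation on `σ` (the carrier `A = B = 0`), a relation
    obtain ⟨z, hz, hzi⟩ := exists_zeroRep (isSemialgebraic_oval hΔ)
    refine ⟨0, 0, z, hz, fun p _ => ?_, ?_⟩
    · rw [hzi]
      simp
    · rw [zero_sub]
      exact relations.neg_mem (of_mem_relations_of_eqOn_zero z (by rw [hzi]; exact fun _ _ => rfl))
  | add x y _ _ ihx ihy =>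
    -- sums merge by ONE instance of rule 1b on the common domain `σ`
    obtain ⟨A₁, B₁, s₁, hs₁, hs₁i, hx⟩ := ihx
    obtain ⟨A₂, B₂, s₂, hs₂, hs₂i, hy⟩ := ihy
    obtain ⟨s, hs, hsi⟩ := hrep (A₁ + A₂) (B₁ + B₂)
    refine ⟨A₁ + A₂, B₁ + B₂, s, hs, fun p _ => by rw [hsi], ?_⟩
    have h1b : KZ.of s - KZ.of s₁ - KZ.of s₂ ∈ KZ.relations := by
      refine integrandAddRel_subset_relations
        ⟨1, s, s₁, s₂, hs₁.trans hs.symm, hs₂.trans hs.symm, fun p hp => ?_, rfl⟩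
      rw [hs] at hp
      rw [Pi.add_apply, hs₁i hp, hs₂i hp, hsi]
      simp only [map_add, add_div]
      ring
    have : x + y - KZ.of s =
        (x - KZ.of s₁) + (y - KZ.of s₂) - (KZ.of s - KZ.of s₁ - KZ.of s₂) := by abel
    rw [this]
    exact relations.sub_mem (relations.add_mem hx hy) h1b
  | neg x _ ih =>
    -- negatives: the carrier `(-A, -B)` has the opposite integrand on `σ`
    obtain ⟨A, B, s, hs, hsi, hx⟩ := ih
    obtain ⟨s', hs', hs'i⟩ := hrep (-A) (-B)
    refine ⟨-A, -B, s', hs', fun p _ => by rw [hs'i], ?_⟩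
    have hneg : KZ.of s + KZ.of s' ∈ KZ.relations := by
      refine of_add_of_mem_relations_of_eqOn_neg (hs'.trans hs.symm) fun p hp => ?_
      rw [hs] at hp
      rw [Pi.neg_apply, hsi hp, hs'i]
      simp only [map_neg, neg_div]
      ring
    have : -x - KZ.of s' = -(x - KZ.of s) - (KZ.of s + KZ.of s') := by abel
    rw [this]
    exact relations.sub_mem (relations.neg_mem hx) hneg

end Summit.KontsevichZagierPeriods.HermiteRigidity.EllipticMomentKernel
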